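import Mathlib

/-!
# HALF-L for `a₃` adjacent exactly to `a₁` and `o`: the ten-cell polynomial form
(blind cell PercRepro2, night-1 g37; own code `mining/night-1/g37/deg2_rootmark.py`, `gen_rootmark_lean.py`)

With `a₃` attached only to the root `a₁` (weight `r₁`) and the mark `o` (weight `r₂`), every mass of the `L`-half of
(HCOV) is a polynomial in `r₁, r₂` and the TEN cells of the `(o, b)`-pattern law of `G′ = G − a₃` under
`Q₀ = {a₁ ↮ a₂}` (law `p[e₁ ↦ 0][e₂ ↦ 0]`): `c.XY = P₀(Q₀, o ∈ X, b ∈ Y)` for `X, Y ∈ {L, H, N}` with the cell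
`NN` split into `NNs` (`o` and `b` in the same non-root cluster) and `NNd` (different clusters) — when both edges
are open the mark's cluster joins the root's cluster through `a₃`, carrying the other mark with it exactly
when the two are in the same base cluster.  `lhs = D · P(Q)² · Cov_Q(1_{bL}, Ξ_γ)` in the ten masses
`Q, bL, T, TbL, TbLoU, oH, bLoH, ToU, PD, PDoU` (`ΓLc = 2 · lhs`); the blocks are the BHK06 two-mark
inequalities of the base law on the nine marginal cells (`NN = NNs + NNd`).
-/

namespace Summit.Ventures.PercRepro2

namespace HalfLA1O

/-- The ten cells of the `(o, b)`-pattern law (`NN` split by `o ~ b`). -/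
structure Cells10 (R : Type*) where
  /-- `o ∈ L, b ∈ L` -/
  LL : R
  /-- `o ∈ L, b ∈ H` -/
  LH : R
  /-- `o ∈ L, b ∉ U` -/
  LN : R
  /-- `o ∈ H, b ∈ L` -/
  HL : R
  /-- `o ∈ H, b ∈ H` -/
  HH : R
  /-- `o ∈ H, b ∉ U` -/
  HN : R
  /-- `o ∉ U, b ∈ L` -/
  NL : R
  /-- `o ∉ U, b ∈ H` -/
  NH : R
  /-- `o, b ∉ U`, same cluster -/
  NNs : R
  /-- `o, b ∉ U`, different clusters -/
  NNd : R

section Polys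

variable {R : Type*} [CommRing R]

/-- The mass `P(Q)` in `r₁, r₂` and the cells. -/
def mQ (r₁ r₂ : R) (c : Cells10 R) : R :=
  c.NNd + c.NNs + c.NH + c.NL + c.HN + c.HH + c.HL + c.LN + c.LH + c.LL - r₁ * r₂ * c.HN - r₁ * r₂ * c.HH - r₁ * r₂ * c.HL

/-- The mass `P(Q, b ∈ L)` in `r₁, r₂` and the cells. -/
def mbL (r₁ r₂ : R) (c : Cells10 R) : R :=
  c.NL + c.HL + c.LL + r₁ * r₂ * c.NNs - r₁ * r₂ * c.HL

/-- The mass `P(T) = P(Q, a₃ ∈ H)` in `r₁, r₂` and the cells. -/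
def mT (r₁ r₂ : R) (c : Cells10 R) : R :=
  r₂ * c.HN + r₂ * c.HH + r₂ * c.HL - r₁ * r₂ * c.HN - r₁ * r₂ * c.HH - r₁ * r₂ * c.HL

/-- The mass `P(T, b ∈ L)` in `r₁, r₂` and the cells. -/
def mTbL (r₁ r₂ : R) (c : Cells10 R) : R :=
  r₂ * c.HL - r₁ * r₂ * c.HL

/-- The mass `P(T, b ∈ L, o ∈ U)` in `r₁, r₂` and the cells. -/
def mTbLoU (r₁ r₂ : R) (c : Cells10 R) : R :=
  r₂ * c.HL - r₁ * r₂ * c.HL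

/-- The mass `P(Q, o ∈ H)` in `r₁, r₂` and the cells. -/
def moH (r₁ r₂ : R) (c : Cells10 R) : R :=
  c.HN + c.HH + c.HL - r₁ * r₂ * c.HN - r₁ * r₂ * c.HH - r₁ * r₂ * c.HL

/-- The mass `P(Q, b ∈ L, o ∈ H)` in `r₁, r₂` and the cells. -/
def mbLoH (r₁ r₂ : R) (c : Cells10 R) : R :=
  c.HL - r₁ * r₂ * c.HL

/-- The mass `P(T, o ∈ U)` in `r₁, r₂` and the cells. -/
def mToU (r₁ r₂ : R) (c : Cells10 R) : R :=
  r₂ * c.HN + r₂ * c.HH + r₂ * c.HL - r₁ * r₂ * c.HN - r₁ * r₂ * c.HH - r₁ * r₂ * c.HL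

/-- The mass `P(PD) = P(Q, a₃ ∉ U)` in `r₁, r₂` and the cells. -/
def mPD (r₁ r₂ : R) (c : Cells10 R) : R :=
  c.NNd + c.NNs + c.NH + c.NL + c.HN + c.HH + c.HL + c.LN + c.LH + c.LL - r₂ * c.HN - r₂ * c.HH - r₂ * c.HL - r₂ * c.LN - r₂ * c.LH - r₂ * c.LL - r₁ * c.NNd - r₁ * c.NNs - r₁ * c.NH - r₁ * c.NL - r₁ * c.HN - r₁ * c.HH - r₁ * c.HL - r₁ * c.LN - r₁ * c.LH - r₁ * c.LL + r₁ * r₂ * c.HN + r₁ * r₂ * c.HH + r₁ * r₂ * c.HL + r₁ * r₂ * c.LN + r₁ * r₂ * c.LH + r₁ * r₂ * c.LL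

/-- The mass `P(PD, o ∈ U)` in `r₁, r₂` and the cells. -/
def mPDoU (r₁ r₂ : R) (c : Cells10 R) : R :=
  c.HN + c.HH + c.HL + c.LN + c.LH + c.LL - r₂ * c.HN - r₂ * c.HH - r₂ * c.HL - r₂ * c.LN - r₂ * c.LH - r₂ * c.LL - r₁ * c.HN - r₁ * c.HH - r₁ * c.HL - r₁ * c.LN - r₁ * c.LH - r₁ * c.LL + r₁ * r₂ * c.HN + r₁ * r₂ * c.HH + r₁ * r₂ * c.HL + r₁ * r₂ * c.LN + r₁ * r₂ * c.LH + r₁ * r₂ * c.LL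

/-- `lhs = D · P(Q)² · Cov_Q(1_{bL}, Ξ_γ)` in the ten masses. -/
def lhs (r₁ r₂ : R) (c : Cells10 R) : R :=
  mQ r₁ r₂ c * (mPD r₁ r₂ c * (mTbLoU r₁ r₂ c - mbLoH r₁ r₂ c) - mPDoU r₁ r₂ c * mTbL r₁ r₂ c) -
    mbL r₁ r₂ c * (mPD r₁ r₂ c * (mToU r₁ r₂ c - moH r₁ r₂ c) - mPDoU r₁ r₂ c * mT r₁ r₂ c)

/-- Block `ge_L_L` (a BHK06 inequality of the base law, nine marginal cells). -/
def blkLL (c : Cells10 R) : R :=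
  -c.LN * c.NL - c.LN * c.HL - c.LH * c.NL - c.LH * c.HL + c.LL * c.NNd + c.LL * c.NNs + c.LL * c.NH + c.LL * c.HN + c.LL * c.HH

/-- Block `ge_H_H` (a BHK06 inequality of the base law, nine marginal cells). -/
def blkHH (c : Cells10 R) : R :=
  -c.HN * c.NH + c.HH * c.NNd + c.HH * c.NNs + c.HH * c.NL - c.HL * c.NH + c.LN * c.HH - c.LH * c.HN - c.LH * c.HL + c.LL * c.HH

/-- Block `ge_H_HN` (a BHK06 inequality of the base law, nine marginal cells). -/
def blkHHN (c : Cells10 R) : R :=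
  c.HN * c.NL + c.HH * c.NL - c.HL * c.NNd - c.HL * c.NNs - c.HL * c.NH - c.LN * c.HL - c.LH * c.HL + c.LL * c.HN + c.LL * c.HH

/-- Block `M2` (a BHK06 inequality of the base law, nine marginal cells). -/
def blkM2 (c : Cells10 R) : R :=
  c.HN * c.NL - c.HL * c.NNd - c.HL * c.NNs - c.LN * c.HL + c.LL * c.HN

/-- Block `M1o` (a BHK06 inequality of the base law, nine marginal cells). -/
def blkM1o (c : Cells10 R) : R :=
  c.HN * c.NL + c.HH * c.NL - c.HL * c.NNd - c.HL * c.NNs - c.HL * c.NH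

end Polys

end HalfLA1O

end Summit.Ventures.PercRepro2
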